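import Summits.CriticalPhenomena.PercolationContinuityZ3.Theorems.PercNearOneGluingNoHeavyPcintChordMemZ3B10Check1
import Summits.CriticalPhenomena.PercolationContinuityZ3.Theorems.PercNearOneGluingNoHeavyPcintChordMemZ3B10Check2
import Summits.CriticalPhenomena.PercolationContinuityZ3.Theorems.PercNearOneGluingNoHeavyPcintChordMemZ3B10Check3
import HarnessLib

/-!
# PCINT lane, kernel reduced-state B3r certificate `Z3B10` (bond, d = 3, memory τ = 10, 3084 state classes): the theorem `p_c^bond(ℤ^3) ≥ 0.2208`

Cell `prim-pcint`, seat `prim-pcint-2` (gen 4); memo `run/shared/lean/prim/pcint/REDUCTIONS.md` §B3r and HANDOFF ("B3r on reduced states").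
Does NOT build on p205010.  Data for `BondK.le_criticalProb_of_checkRowsB` (`…PcintChordMemKernelCert`): `p = 22080/100000`,
`s̄ = 97532/100000` (`s̄²+p² ≥ 1`), refund `r = 102531/100000` (`s̄·r ≥ 1`, `(1-p)·r ≤ 1`), `κ̄ = (100000+97532)/(2·100000)`, `λ = 99999/100000`;
Collatz–Wielandt weights (scale 10⁹) from a power iteration (ρ ≈ 0.9997755), exact off-line max row ratio 0.9997754714 < λ.
Generated by work/gen/gen_b3r_kernel.py (prim-pcint-2 gen 4 folder; copy in run/shared/lean/prim/pcint/prim-pcint-2/kernel/); the kernel re-checks every row.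
-/

namespace Summit.CriticalPhenomena.PercolationContinuityZ3.Theorems.Pcint

open Literature.Probability.Percolation Literature.Probability.LatticeModels

/-- Every row of the certificate passes. [folklore] -/
theorem ChordMemZ3B10.all_rows : WinK.allRange (BondK.checkRowB 10 3 3084 22080 102531 97532 100000 99999 100000 ChordMemZ3B10.syms ChordMemZ3B10.tree) 0 3084 = true := (WinK.allRange_split (WinK.allRange_split ChordMemZ3B10.file_1 ChordMemZ3B10.file_2) ChordMemZ3B10.file_3)

/-- **`p_c^bond(ℤ^3) ≥ 0.2208`** (kernel-checked reduced-state B3r certificate: `chordrand` weights on the memory-`10` dangerous-set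
automaton, 3084 state classes, `decide +kernel` only). [folklore] -/
theorem criticalProb_Z3_ge_02208 : (0.2208 : ℝ) ≤ criticalProb (zdGraph 3) 0 := by
  have h := BondK.le_criticalProb_of_checkRowsB (d := 3) (τ := 10) (N := 3084) (pn := 22080) (R := 102531) (S := 97532) (D := 100000)
    (lamN := 99999) (lamD := 100000) (syms := ChordMemZ3B10.syms) (t := ChordMemZ3B10.tree) (by norm_num)
    (fun c => NawK.symOfTab 3 (ChordMemZ3B10.syms.getD c [])) (NawK.syms_spec_of_valid ChordMemZ3B10.syms_valid)
    (fun i hi => WinK.of_allRange ChordMemZ3B10.all_rows (Nat.zero_le i) hi)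
    (by norm_num) (by decide +kernel) (by norm_num) (by norm_num) (by norm_num) (by norm_num) (by norm_num) (by norm_num)
    (by norm_num) (by norm_num)
  have e : ((22080 : ℕ) : ℝ) / ((100000 : ℕ) : ℝ) = (0.2208 : ℝ) := by norm_num
  rw [e] at h
  exact h

end Summit.CriticalPhenomena.PercolationContinuityZ3.Theorems.Pcint
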